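import Summits.PneNP.PneNP.Theorems.ChebyshevTracialDesignScalarPeeling
import Summits.PneNP.PneNP.Theorems.ChebyshevTracialDesignDimTwoSynchronisation
import HarnessLib

/-!
# Cell pnp-psdrank, route `ChebyshevTracialDesign`: THE DENSE NON-CROSSING PSD CELL AT `r = 2` — general pairs, by peeling + synchronisation

Composition of bricks 58 (scalar peeling), 59 (synchronisation tools), 60 (`2 × 2` algebra) and 61 (synchronisation of singular pairs) for the crux
`TracialDecayExp20` (stmt-PneNP-19878), brick 62 (prover g11; MEMO-14 §5 (a) in full). `denseCell_dim_two_value_le`: for a level weight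
`W = levelWeight n t C w` (`Σ|w_c| ≤ B_v`) with ONE-dimensional tracial value `≤ γ` (the `r = 1` rung), a tight-orthogonal psd rectangle `(X, Y)`
of dimension `2` on the `t`-cuts, and the quantitative non-tightness hypothesis `hSNT` — every `[0,1]` cut weight of mass `≥ ε·#t-cuts` and every
sub-weight of `tr(Y_·)/2` carrying at least a QUARTER of its mass have an active tight pair (the cell's (SNT-q) for a homogeneous-dense matching
side, mod Keevash–Lifshitz; brick 59 `isRelHomogeneousW_of_le_of_half` twice) —
      `Σ_U Σ_M W(U,M)·tr(X_U Y_M) ≤ 6γ + 4·B_v·ε`.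
Steps: peel `λ_min(X_U)` off every cut operator (brick 58 `value_le_peel_left`, cost `2γ`; brick 60 `exists_lowerBound_singular` makes the remainder
singular); if the singular cut side has mass `< 2ε·#t-cuts` it is junk (brick 51, `≤ 4B_v ε`); otherwise the matchings with `Y_M ≻ 0` carry less
than a quarter of the matching mass (an active tight partner of a positive definite `Y_M` would vanish — brick 59 — contradicting `hSNT`), so peeling
`λ_min(Y_M)` (cost `2γ`) keeps at least HALF of the matching mass (`3/4` in fact) and produces a singular pair to which brick 61 applies
(`≤ 2γ + 4B_v ε`). This is the dense cell at `r = 2` WITHOUT a net; its only inputs are the `r = 1` rung and (SNT-q).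
[cite: Rothvoss2017, §2 (PDF p. 6)] [cite: BrietDadushPokutta2014, Thm. 6 (§3)] [cite: KupavskiiZakharov2022, §2]
Stature: support/instrument (no defs; (SNT-q) and the `r = 1` rung are hypotheses). WHAT THIS IS NOT: not the dense cell for `r > 2`, nothing on
psd rank, no P-vs-NP content. Supports stmt-PneNP-19878.
-/

set_option linter.dupNamespace false -- `Summit.PneNP.PneNP.…`: summit = sub-problem (D-0017)

noncomputable section

namespace Summit.PneNP.PneNP.Theorems.ChebyshevTracialDesignDimTwoDenseCell

open Finset Matrix Literature.Barriers.PneNP Literature.Combinatorics.Optimization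
open Summit.PneNP.PneNP.Theorems.ChebyshevTracialDesignPsdCells (abs_cell_value_le_row)
open Summit.PneNP.PneNP.Theorems.ChebyshevTracialDesignScalarPeeling (isPsdRect_peel_left value_le_peel_left isPsdRect_peel_right
  value_le_peel_right)
open Summit.PneNP.PneNP.Theorems.ChebyshevTracialDesignSynchronisationTools (no_active_tight_pair_of_posDef_right)
open Summit.PneNP.PneNP.Theorems.ChebyshevTracialDesignDimTwoAlgebra (exists_lowerBound_singular)
open Summit.PneNP.PneNP.Theorems.ChebyshevTracialDesignDimTwoSynchronisation (singular_pair_value_le)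

variable {n : ℕ}

set_option maxHeartbeats 400000 in
/-- **THE DENSE CELL AT `r = 2`.** For `W = levelWeight n t C w` with `Σ|w_c| ≤ B_v`, `TracialValueLEAt W γ 1`, a tight-orthogonal psd rectangle
`(X, Y)` of dimension `2` supported on the `t`-cuts, `ε > 0`, and the (SNT-q) hypothesis `hSNT` (every `[0,1]` cut weight of mass `≥ ε·#t-cuts` and
every sub-weight `y' ≤ tr(Y_·)/2` with `Σ_M tr(Y_M)/2 ≤ 4·Σ_M y'_M` admit `U, M` with `cc(U,M) = 1`, `x_U > 0`, `y'_M > 0`):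
`Σ_U Σ_M W(U,M)·tr(X_U Y_M) ≤ 6γ + 4·B_v·ε`. [cite: Rothvoss2017, §2 (PDF p. 6)] [cite: BrietDadushPokutta2014, Thm. 6 (§3)] -/
theorem denseCell_dim_two_value_le {t : ℕ} (C : Finset ℕ) (w : ℕ → ℝ) {Bv γ ε : ℝ} (hBv : ∑ c ∈ C, |w c| ≤ Bv) (hε : 0 < ε)
    (hγ : TracialValueLEAt (levelWeight n t C w) γ 1)
    {X : OddSet n → Matrix (Fin 2) (Fin 2) ℝ} {Y : PMatch n → Matrix (Fin 2) (Fin 2) ℝ} (hXY : IsPsdRect X Y)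
    (hXt : ∀ U, U.1.card ≠ t → X U = 0)
    (hSNT : ∀ (x : OddSet n → ℝ) (y' : PMatch n → ℝ), (∀ U, 0 ≤ x U ∧ x U ≤ 1) → (∀ U, U.1.card ≠ t → x U = 0) →
      ε * ((univ.filter fun U : OddSet n => U.1.card = t).card : ℝ) ≤ ∑ U, x U →
      (∀ M, 0 ≤ y' M ∧ y' M ≤ (Y M).trace / 2) → (∑ M, (Y M).trace / 2) ≤ 4 * ∑ M, y' M →
      ∃ U M, cc U M = 1 ∧ 0 < x U ∧ 0 < y' M) :
    ∑ U, ∑ M, levelWeight n t C w U M * (X U * Y M).trace ≤ 6 * γ + 4 * Bv * ε := by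
  classical
  set Nt : ℝ := ((univ.filter fun U : OddSet n => U.1.card = t).card : ℝ) with hNt
  have hBv0 : 0 ≤ Bv := (sum_nonneg fun c _ => abs_nonneg (w c)).trans hBv
  have hNt0 : (0 : ℝ) ≤ Nt := by rw [hNt]; positivity
  have hγ0 : 0 ≤ γ := by
    have h := hγ (fun _ => 0) (fun _ => 0) ⟨fun _ => ⟨PosSemidef.zero, by rw [sub_zero]; exact PosSemidef.one⟩,
      fun _ => ⟨PosSemidef.zero, by rw [sub_zero]; exact PosSemidef.one⟩, fun _ _ _ => Matrix.zero_mul _⟩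
    simpa using h
  have two_pos' : (0 : ℕ) < 2 := by norm_num
  -- STEP 1: peel the cut side
  have hlamex := fun U => exists_lowerBound_singular (hXY.1 U).1
  choose lam hlam0 hlam hlamdet using hlamex
  set X' : OddSet n → Matrix (Fin 2) (Fin 2) ℝ := fun U => X U - lam U • (1 : Matrix (Fin 2) (Fin 2) ℝ) with hX'
  have hX'Y : IsPsdRect X' Y := isPsdRect_peel_left hXY hlam0 hlam
  have hpeelX : ∑ U, ∑ M, levelWeight n t C w U M * (X U * Y M).trace ≤
      ∑ U, ∑ M, levelWeight n t C w U M * (X' U * Y M).trace + 2 * γ := by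
    have h := value_le_peel_left two_pos' (levelWeight n t C w) hγ hXY hlam0 hlam
    norm_num at h
    exact h
  have hX't : ∀ U, U.1.card ≠ t → X' U = 0 := by
    intro U hU
    have h0 : X U = 0 := hXt U hU
    have hl : lam U = 0 := by
      have h := (hlam U).trace_nonneg
      rw [h0, zero_sub, trace_neg, trace_smul, trace_one, Fintype.card_fin, smul_eq_mul] at h
      norm_num at h
      linarith [hlam0 U]
    show X U - lam U • (1 : Matrix (Fin 2) (Fin 2) ℝ) = 0
    rw [h0, hl, zero_smul, sub_zero]
  have hX'det : ∀ U, (X' U).det = 0 := hlamdet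
  -- STEP 2: junk branch
  by_cases hdens : ∑ U, (X' U).trace / 2 < 2 * (ε * Nt)
  · have h1 := abs_cell_value_le_row (t := t) two_pos' C w hX'Y univ univ
    have hNt' : ((univ.filter fun U : OddSet n => U.1.card = t).card : ℝ) = Nt := rfl
    rw [hNt'] at h1
    have hmass : ∑ U ∈ univ.filter (fun U : OddSet n => U.1.card = t), (X' U).trace ≤ 2 * (2 * (ε * Nt)) := by
      calc ∑ U ∈ univ.filter (fun U : OddSet n => U.1.card = t), (X' U).trace ≤ ∑ U, (X' U).trace :=
            sum_le_sum_of_subset_of_nonneg (filter_subset _ _) fun U _ _ => (hX'Y.1 U).1.trace_nonneg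
        _ = 2 * ∑ U, (X' U).trace / 2 := by rw [mul_sum]; exact sum_congr rfl fun U _ => by ring
        _ ≤ 2 * (2 * (ε * Nt)) := by linarith
    have hjunk : ∑ U, ∑ M, levelWeight n t C w U M * (X' U * Y M).trace ≤ 4 * Bv * ε := by
      rcases (show (0 : ℝ) ≤ Nt by rw [hNt]; positivity).eq_or_lt with hN0 | hNpos
      · -- no `t`-cuts: `X' = 0`
        have hall : ∀ U : OddSet n, X' U = 0 := by
          intro U
          by_cases hU : U.1.card = t
          · exfalso
            have : (0 : ℝ) < Nt := by rw [hNt]; exact_mod_cast card_pos.2 ⟨U, mem_filter.2 ⟨mem_univ _, hU⟩⟩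
            linarith
          · exact hX't U hU
        have : ∑ U, ∑ M, levelWeight n t C w U M * (X' U * Y M).trace = 0 :=
          sum_eq_zero fun U _ => sum_eq_zero fun M _ => by rw [hall U, Matrix.zero_mul, trace_zero, mul_zero]
        rw [this]; positivity
      calc _ ≤ |∑ U ∈ univ, ∑ M ∈ univ, levelWeight n t C w U M * (X' U * Y M).trace| := le_abs_self _
        _ ≤ (∑ c ∈ C, |w c|) * ((∑ U ∈ univ.filter (fun U : OddSet n => U.1.card = t), (X' U).trace) / Nt) := h1
        _ ≤ Bv * (2 * (2 * (ε * Nt)) / Nt) :=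
            mul_le_mul hBv (div_le_div_of_nonneg_right hmass hNpos.le)
              (div_nonneg (sum_nonneg fun U _ => (hX'Y.1 U).1.trace_nonneg) hNpos.le) hBv0
        _ = 4 * Bv * ε := by field_simp; ring
    nlinarith [hjunk, hpeelX, hγ0, hBv0, hε]
  push Not at hdens
  -- STEP 3: the matchings with positive definite `Y_M` carry less than a quarter of the mass; peel the matching side
  have hkapex := fun M => exists_lowerBound_singular (hXY.2.1 M).1
  choose kap hkap0 hkap hkapdet using hkapex
  have hkaptr : ∀ M, kap M ≤ (Y M).trace / 2 := by
    intro M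
    have h := (hkap M).trace_nonneg
    rw [trace_sub, trace_smul, trace_one, Fintype.card_fin, smul_eq_mul] at h
    norm_num at h
    linarith
  set B₂ := (univ : Finset (PMatch n)).filter (fun M => 0 < kap M) with hB₂
  have hB₂small : 4 * ∑ M ∈ B₂, (Y M).trace / 2 < ∑ M, (Y M).trace / 2 := by
    by_contra hge
    push Not at hge
    set x : OddSet n → ℝ := fun U => (X' U).trace / 2 with hx
    set y' : PMatch n → ℝ := fun M => if M ∈ B₂ then (Y M).trace / 2 else 0 with hy'
    have hx01 : ∀ U, 0 ≤ x U ∧ x U ≤ 1 := fun U =>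
      ⟨div_nonneg (hX'Y.1 U).1.trace_nonneg two_pos.le, by
        have h := (hX'Y.1 U).2.trace_nonneg
        rw [trace_sub, trace_one, Fintype.card_fin] at h
        rw [hx]; dsimp only; rw [div_le_one (by norm_num : (0:ℝ) < 2)]; norm_num at h; linarith⟩
    have hxt : ∀ U, U.1.card ≠ t → x U = 0 := fun U hU => by rw [hx]; dsimp only; rw [hX't U hU, trace_zero, zero_div]
    have hy'01 : ∀ M, 0 ≤ y' M ∧ y' M ≤ (Y M).trace / 2 := by
      intro M; rw [hy']; dsimp only; split_ifs
      · exact ⟨div_nonneg (hXY.2.1 M).1.trace_nonneg two_pos.le, le_rfl⟩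
      · exact ⟨le_rfl, div_nonneg (hXY.2.1 M).1.trace_nonneg two_pos.le⟩
    have hy'sum : ∑ M, y' M = ∑ M ∈ B₂, (Y M).trace / 2 := by
      rw [hy', ← sum_filter, filter_mem_eq_inter, univ_inter]
    obtain ⟨U, M, hcc, hxU, hyM⟩ := hSNT x y' hx01 hxt (by linarith [hdens, mul_nonneg hε.le hNt0]) hy'01 (by rw [hy'sum]; exact hge)
    have hMB : M ∈ B₂ := by
      by_contra h; rw [hy'] at hyM; dsimp only at hyM; rw [if_neg h] at hyM; exact lt_irrefl _ hyM
    have hX0 : X' U = 0 :=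
      no_active_tight_pair_of_posDef_right hX'Y (B := B₂) (kap := kap) (fun M hM => (mem_filter.1 hM).2) (fun M _ => hkap M) hMB hcc
    rw [hx] at hxU; dsimp only at hxU
    rw [hX0, trace_zero, zero_div] at hxU
    exact lt_irrefl _ hxU
  set Y' : PMatch n → Matrix (Fin 2) (Fin 2) ℝ := fun M => Y M - kap M • (1 : Matrix (Fin 2) (Fin 2) ℝ) with hY'
  have hX'Y' : IsPsdRect X' Y' := isPsdRect_peel_right hX'Y hkap0 hkap
  have hpeelY : ∑ U, ∑ M, levelWeight n t C w U M * (X' U * Y M).trace ≤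
      ∑ U, ∑ M, levelWeight n t C w U M * (X' U * Y' M).trace + 2 * γ := by
    have h := value_le_peel_right two_pos' (levelWeight n t C w) hγ hX'Y hkap0 hkap
    norm_num at h
    exact h
  have hY'det : ∀ M, (Y' M).det = 0 := hkapdet
  -- the peeled matching side keeps at least half (indeed three quarters) of the mass
  have hY'tr : ∀ M, (Y' M).trace / 2 = (Y M).trace / 2 - kap M := by
    intro M; show (Y M - kap M • (1 : Matrix (Fin 2) (Fin 2) ℝ)).trace / 2 = _
    rw [trace_sub, trace_smul, trace_one, Fintype.card_fin, smul_eq_mul]; norm_num; ring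
  have hkapsum : ∑ M, kap M ≤ ∑ M ∈ B₂, (Y M).trace / 2 := by
    have h1 : ∑ M, kap M = ∑ M ∈ B₂, kap M := by
      rw [hB₂, sum_filter]
      refine sum_congr rfl fun M _ => ?_
      split_ifs with h
      · rfl
      · exact le_antisymm (not_lt.1 h) (hkap0 M)
    rw [h1]; exact sum_le_sum fun M _ => hkaptr M
  have hhalf : ∑ M, (Y M).trace / 2 ≤ 2 * ∑ M, (Y' M).trace / 2 := by
    have : ∑ M, (Y' M).trace / 2 = ∑ M, (Y M).trace / 2 - ∑ M, kap M := by
      rw [← sum_sub_distrib]; exact sum_congr rfl fun M _ => hY'tr M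
    rw [this]
    have h0 : 0 ≤ ∑ M ∈ B₂, (Y M).trace / 2 := sum_nonneg fun M _ => div_nonneg (hXY.2.1 M).1.trace_nonneg two_pos.le
    linarith
  -- (SNT-q) for the peeled matching side
  have hSNT' : ∀ (x : OddSet n → ℝ) (y' : PMatch n → ℝ), (∀ U, 0 ≤ x U ∧ x U ≤ 1) → (∀ U, U.1.card ≠ t → x U = 0) →
      ε * ((univ.filter fun U : OddSet n => U.1.card = t).card : ℝ) ≤ ∑ U, x U →
      (∀ M, 0 ≤ y' M ∧ y' M ≤ (Y' M).trace / 2) → (∑ M, (Y' M).trace / 2) ≤ 2 * ∑ M, y' M →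
      ∃ U M, cc U M = 1 ∧ 0 < x U ∧ 0 < y' M := by
    intro x y' hx01 hxt hxd hy'01 hy'half
    refine hSNT x y' hx01 hxt hxd (fun M => ⟨(hy'01 M).1, (hy'01 M).2.trans ?_⟩) (by linarith)
    rw [hY'tr M]; linarith [hkap0 M]
  -- STEP 4: synchronisation of the singular pair
  have hcore := singular_pair_value_le C w hBv hε hγ hX'Y' hX't hX'det hY'det hSNT' hdens
  linarith

end Summit.PneNP.PneNP.Theorems.ChebyshevTracialDesignDimTwoDenseCell
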